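import Literature.NumberTheory.LFunctions.Zhang2022.RepairFrakc3S

/-!
# Zhang (2022), repair rung F-S1R, K-S2 (window part, reduction step): on the design the exact
# window form sees only the two overlaps `[1−ν₂, ν₁]`, `[1−ν₃, ν₁]` — `ι₂` drops out

Y. Zhang, *Discrete mean estimates and the Landau–Siegel zero*, arXiv:2211.02515v1 (2022)
[Zhang2022LandauSiegel] — an unrefereed manuscript under adjudication; nothing here is a claim about
its Theorems 1–2. Follow-on of `RepairFrakc3S` (`frakc3S = F0part + WT`, `discS = WT − 2e₂*`): the
window form `W(u,v)` of `RepairCrossSlotForm` is sesquilinear on `H¹` profiles, and for two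
`ϰ`-pieces whose lengths do not overlap after reflection (`ν_a + ν_b ≤ 1`) every one of its four
integrands vanishes identically on `[0,1]`. Consequently, on the admissible class (`ν₃ < ν₂ ≤ 1/2 < ν₁`,
so the `ι₂ϰ(ν₂,k₂)`-piece of `H₁` never meets the reflected `H₂`):

`WT θ = ῑ₄·Xw ν₁ k₁ ν₂ k₂ + ῑ₃·Xw ν₁ k₁ ν₃ k₃`, `Xw ν_a k_a ν_b k_b := W(ϰ(ν_a,k_a), R̃ϰ(ν_b,k_b))`
(integrands supported on `[1−ν_b, ν_a]`, of length `ν_a + ν_b − 1`: `L₇ = 0.004` for `b = 2`,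
`L₆ = 0.002` for `b = 3` in print — the two ranges of (12.12)–(12.14), which the manuscript evaluates
after linearising as `e₁* + 2e₂*`; compare `e2starT = (4/(ν₁π))(ῑ₃I₆/ν₃ + ῑ₄I₇/ν₂)`, the same
`ῑ₃ / ῑ₄` split window by window).

* `intervalIntegrable_mul_conj_deriv'` (`u·conj v′ ∈ L¹`), `windowForm_add_smul_left/right`
  (sesquilinearity on `H¹`), `windowForm_zero_left/right`;
* `reflProfile_add_smul`, `reflDeriv_add_smul` (`R̃` is conjugate-linear);
* `Xw`, `windowForm_kappaP_refl_eq_zero` (`ν_a + ν_b ≤ 1 ⇒ Xw ν_a k_a ν_b k_b = 0`);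
* **`WT_eq_windows`** and **`discS_eq_windows : discS θ = ῑ₄·Xw ν₁ k₁ ν₂ k₂ + ῑ₃·Xw ν₁ k₁ ν₃ k₃ − 2·e2starT θ`**
  on `AdmissibleTheta θ`.

The closed forms of `Xw` (exp-quadratic integrals over `[0, ν_a + ν_b − 1]`, polynomial branch when
`k_b = k_a`) and the kernel enclosure at `θ₀` are the next step (`repair/p1/KS2-WINDOW.md`).
Calculus bookkeeping only; no `Prop` facts.
-/

noncomputable section

open Complex Real ComplexConjugate Set MeasureTheory intervalIntegral

namespace Literature.NumberTheory.LFunctions.Zhang2022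

namespace Repair

variable {u u' v v' f f' : ℝ → ℂ} {θ : Theta}

/-! ### Sesquilinearity of the window form on `H¹` profiles -/

/-- The zero profile is `H¹` (plumbing). [folklore] -/
private theorem isH1_zero' : IsH1OnUnitInterval (fun _ : ℝ => (0:ℂ)) (fun _ : ℝ => (0:ℂ)) :=
  kinkedProfile_zero.isH1

/-- `H¹` is closed under scalars (plumbing). [folklore] -/
private theorem isH1_smul (hf : IsH1OnUnitInterval f f') (t : ℂ) :
    IsH1OnUnitInterval (fun x => t * f x) (fun x => t * f' x) := by
  have h := isH1_zero'.add_smul hf t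
  simp only [zero_add] at h
  exact h

/-- `u · conj v′` is integrable on `[0,1]` (`C⁰ × L²`). [cite: Zhang2022LandauSiegel, §18 (18.1)] -/
theorem intervalIntegrable_mul_conj_deriv' (hu : IsH1OnUnitInterval u u') (hv : IsH1OnUnitInterval v v') :
    IntervalIntegrable (fun x => u x * conj (v' x)) volume 0 1 := by
  have h1 : IntervalIntegrable (fun x => conj (v' x)) volume 0 1 := by
    rw [intervalIntegrable_iff, uIoc_of_le zero_le_one]
    exact hv.memLp_conj.integrable one_le_two
  exact h1.continuousOn_mul (by rw [uIcc_of_le zero_le_one]; exact hu.continuousOn)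

/-- Linearity of the window form in the first profile. [cite: Zhang2022LandauSiegel, §18 (18.1)] -/
theorem windowForm_add_smul_left (hu : IsH1OnUnitInterval u u') (hf : IsH1OnUnitInterval f f')
    (hv : IsH1OnUnitInterval v v') (t : ℂ) :
    windowForm (fun x => u x + t * f x) (fun x => u' x + t * f' x) v v'
      = windowForm u u' v v' + t * windowForm f f' v v' := by
  have e1 : (∫ x in (0:ℝ)..1, (u' x + t * f' x) * conj (v' x))
      = (∫ x in (0:ℝ)..1, u' x * conj (v' x)) + t * ∫ x in (0:ℝ)..1, f' x * conj (v' x) := by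
    rw [← intervalIntegral.integral_const_mul, ← intervalIntegral.integral_add
      (hu.intervalIntegrable_deriv_mul_conj_deriv hv)
      ((hf.intervalIntegrable_deriv_mul_conj_deriv hv).const_mul t)]
    exact intervalIntegral.integral_congr fun x _ => by ring
  have e2 : (∫ x in (0:ℝ)..1, (u x + t * f x) * conj (v x))
      = (∫ x in (0:ℝ)..1, u x * conj (v x)) + t * ∫ x in (0:ℝ)..1, f x * conj (v x) := by
    rw [← intervalIntegral.integral_const_mul, ← intervalIntegral.integral_add
      (hu.intervalIntegrable_mul_conj hv) ((hf.intervalIntegrable_mul_conj hv).const_mul t)]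
    exact intervalIntegral.integral_congr fun x _ => by ring
  have e3 : (∫ x in (0:ℝ)..1, (u' x + t * f' x) * conj (v x))
      = (∫ x in (0:ℝ)..1, u' x * conj (v x)) + t * ∫ x in (0:ℝ)..1, f' x * conj (v x) := by
    rw [← intervalIntegral.integral_const_mul, ← intervalIntegral.integral_add
      (hu.intervalIntegrable_deriv_mul_conj hv) ((hf.intervalIntegrable_deriv_mul_conj hv).const_mul t)]
    exact intervalIntegral.integral_congr fun x _ => by ring
  have e4 : (∫ x in (0:ℝ)..1, (u x + t * f x) * conj (v' x))
      = (∫ x in (0:ℝ)..1, u x * conj (v' x)) + t * ∫ x in (0:ℝ)..1, f x * conj (v' x) := by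
    rw [← intervalIntegral.integral_const_mul, ← intervalIntegral.integral_add
      (intervalIntegrable_mul_conj_deriv' hu hv) ((intervalIntegrable_mul_conj_deriv' hf hv).const_mul t)]
    exact intervalIntegral.integral_congr fun x _ => by ring
  have e5 : (∫ x in (0:ℝ)..1, (u x + t * f x) * conj (∫ s in (0:ℝ)..x, v s))
      = (∫ x in (0:ℝ)..1, u x * conj (∫ s in (0:ℝ)..x, v s))
        + t * ∫ x in (0:ℝ)..1, f x * conj (∫ s in (0:ℝ)..x, v s) := by
    rw [← intervalIntegral.integral_const_mul, ← intervalIntegral.integral_add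
      (hu.intervalIntegrable_mul_conj_primitive hv)
      ((hf.intervalIntegrable_mul_conj_primitive hv).const_mul t)]
    exact intervalIntegral.integral_congr fun x _ => by ring
  simp only [windowForm]
  rw [e1, e2, e3, e4, e5]
  ring

/-- Conjugate-linearity of the window form in the second profile. [cite: Zhang2022LandauSiegel, §18 (18.1)] -/
theorem windowForm_add_smul_right (hu : IsH1OnUnitInterval u u') (hv : IsH1OnUnitInterval v v')
    (hf : IsH1OnUnitInterval f f') (t : ℂ) :
    windowForm u u' (fun x => v x + t * f x) (fun x => v' x + t * f' x)
      = windowForm u u' v v' + conj t * windowForm u u' f f' := by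
  have e1 : (∫ x in (0:ℝ)..1, u' x * conj (v' x + t * f' x))
      = (∫ x in (0:ℝ)..1, u' x * conj (v' x)) + conj t * ∫ x in (0:ℝ)..1, u' x * conj (f' x) := by
    rw [← intervalIntegral.integral_const_mul, ← intervalIntegral.integral_add
      (hu.intervalIntegrable_deriv_mul_conj_deriv hv)
      ((hu.intervalIntegrable_deriv_mul_conj_deriv hf).const_mul (conj t))]
    exact intervalIntegral.integral_congr fun x _ => by simp only [map_add, map_mul]; ring
  have e2 : (∫ x in (0:ℝ)..1, u x * conj (v x + t * f x))
      = (∫ x in (0:ℝ)..1, u x * conj (v x)) + conj t * ∫ x in (0:ℝ)..1, u x * conj (f x) := by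
    rw [← intervalIntegral.integral_const_mul, ← intervalIntegral.integral_add
      (hu.intervalIntegrable_mul_conj hv) ((hu.intervalIntegrable_mul_conj hf).const_mul (conj t))]
    exact intervalIntegral.integral_congr fun x _ => by simp only [map_add, map_mul]; ring
  have e3 : (∫ x in (0:ℝ)..1, u' x * conj (v x + t * f x))
      = (∫ x in (0:ℝ)..1, u' x * conj (v x)) + conj t * ∫ x in (0:ℝ)..1, u' x * conj (f x) := by
    rw [← intervalIntegral.integral_const_mul, ← intervalIntegral.integral_add
      (hu.intervalIntegrable_deriv_mul_conj hv) ((hu.intervalIntegrable_deriv_mul_conj hf).const_mul (conj t))]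
    exact intervalIntegral.integral_congr fun x _ => by simp only [map_add, map_mul]; ring
  have e4 : (∫ x in (0:ℝ)..1, u x * conj (v' x + t * f' x))
      = (∫ x in (0:ℝ)..1, u x * conj (v' x)) + conj t * ∫ x in (0:ℝ)..1, u x * conj (f' x) := by
    rw [← intervalIntegral.integral_const_mul, ← intervalIntegral.integral_add
      (intervalIntegrable_mul_conj_deriv' hu hv) ((intervalIntegrable_mul_conj_deriv' hu hf).const_mul (conj t))]
    exact intervalIntegral.integral_congr fun x _ => by simp only [map_add, map_mul]; ring
  have e5 : (∫ x in (0:ℝ)..1, u x * conj (∫ s in (0:ℝ)..x, (v s + t * f s)))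
      = (∫ x in (0:ℝ)..1, u x * conj (∫ s in (0:ℝ)..x, v s))
        + conj t * ∫ x in (0:ℝ)..1, u x * conj (∫ s in (0:ℝ)..x, f s) := by
    rw [← intervalIntegral.integral_const_mul, ← intervalIntegral.integral_add
      (hu.intervalIntegrable_mul_conj_primitive hv)
      ((hu.intervalIntegrable_mul_conj_primitive hf).const_mul (conj t))]
    refine intervalIntegral.integral_congr fun x hx => ?_
    rw [uIcc_of_le zero_le_one] at hx
    simp only [hv.primitive_add_smul hf t hx, map_add, map_mul]
    ring
  simp only [windowForm]
  rw [e1, e2, e3, e4, e5]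
  ring

/-- The window form vanishes when the first profile is zero. [cite: Zhang2022LandauSiegel, §18 (18.1)] -/
theorem windowForm_zero_left (v v' : ℝ → ℂ) :
    windowForm (fun _ => (0:ℂ)) (fun _ => (0:ℂ)) v v' = 0 := by
  simp [windowForm]

/-- The window form vanishes when the second profile is zero. [cite: Zhang2022LandauSiegel, §18 (18.1)] -/
theorem windowForm_zero_right (u u' : ℝ → ℂ) :
    windowForm u u' (fun _ => (0:ℂ)) (fun _ => (0:ℂ)) = 0 := by
  simp [windowForm]

/-- Homogeneity in the first profile. [cite: Zhang2022LandauSiegel, §18 (18.1)] -/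
theorem windowForm_smul_left (hf : IsH1OnUnitInterval f f') (hv : IsH1OnUnitInterval v v') (t : ℂ) :
    windowForm (fun x => t * f x) (fun x => t * f' x) v v' = t * windowForm f f' v v' := by
  have h := windowForm_add_smul_left isH1_zero' hf hv t
  simp only [zero_add] at h
  rw [h, windowForm_zero_left, zero_add]

/-- Conjugate-homogeneity in the second profile. [cite: Zhang2022LandauSiegel, §18 (18.1)] -/
theorem windowForm_smul_right (hu : IsH1OnUnitInterval u u') (hf : IsH1OnUnitInterval f f') (t : ℂ) :
    windowForm u u' (fun x => t * f x) (fun x => t * f' x) = conj t * windowForm u u' f f' := by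
  have h := windowForm_add_smul_right hu isH1_zero' hf t
  simp only [zero_add] at h
  rw [h, windowForm_zero_right, zero_add]

/-! ### `R̃` is conjugate-linear -/

/-- `R̃(a + t·b) = R̃a + conj t · R̃b`. [cite: Zhang2022LandauSiegel, §12 (12.6)–(12.8)] -/
theorem reflProfile_add_smul (a b : ℝ → ℂ) (t : ℂ) :
    reflProfile (fun x => a x + t * b x) = fun y => reflProfile a y + conj t * reflProfile b y := by
  funext y; simp [reflProfile, map_add, map_mul]

/-- `(R̃(a + t·b))′ = (R̃a)′ + conj t · (R̃b)′` for the derivative companions. [cite: Zhang2022LandauSiegel, §12 (12.6)–(12.8)] -/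
theorem reflDeriv_add_smul (a b : ℝ → ℂ) (t : ℂ) :
    reflDeriv (fun x => a x + t * b x) = fun y => reflDeriv a y + conj t * reflDeriv b y := by
  funext y; simp [reflDeriv, map_add, map_mul]; ring

/-! ### One-window forms and the vanishing of non-overlapping pairs -/

/-- The one-window form of a pair of `ϰ`-pieces: `Xw ν_a k_a ν_b k_b := W(ϰ(ν_a,k_a), R̃ϰ(ν_b,k_b))`;
its four integrands are supported on `[1−ν_b, ν_a]`. [cite: Zhang2022LandauSiegel, §12 (12.12)–(12.14); §18 (18.1)] -/
def Xw (νa ka νb kb : ℝ) : ℂ :=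
  windowForm (kappaP νa ka) (kappaP' νa ka) (reflProfile (kappaP νb kb)) (reflDeriv (kappaP' νb kb))

/-- **Non-overlapping pieces do not interact**: if `ν_a + ν_b ≤ 1` (the support `[0,ν_a]` of `ϰ_a` and
the support `[1−ν_b,1]` of `R̃ϰ_b` meet in at most the point `ν_a = 1−ν_b`, where `ϰ_a` vanishes), every
integrand of the window form is identically `0` on `[0,1]`, so `Xw ν_a k_a ν_b k_b = 0`.
[cite: Zhang2022LandauSiegel, §12 (12.1)–(12.2), (15.2)] -/
theorem windowForm_kappaP_refl_eq_zero {νa ka νb kb : ℝ} (ha : 0 < νa) (hb : 0 < νb) (hab : νa + νb ≤ 1) :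
    Xw νa ka νb kb = 0 := by
  -- pointwise vanishing of the four products on `[0,1]`
  have hz1 : ∀ y ∈ uIcc (0:ℝ) 1,
      kappaP' νa ka y * conj (reflDeriv (kappaP' νb kb) y) = 0 := by
    intro y _
    by_cases hy : y < νa
    · have : kappaP' νb kb (1 - y) = 0 := kappaP'_of_ge (by linarith)
      simp [reflDeriv, this]
    · rw [kappaP'_of_ge (not_lt.1 hy), zero_mul]
  have hz2 : ∀ y ∈ uIcc (0:ℝ) 1, kappaP νa ka y * conj (reflProfile (kappaP νb kb) y) = 0 := by
    intro y _
    by_cases hy : y < νa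
    · have : kappaP νb kb (1 - y) = 0 := kappaP_of_lt (by linarith)
      simp [reflProfile, this]
    · rw [kappaP_of_ge ha.ne' (not_lt.1 hy), zero_mul]
  have hz3 : ∀ y ∈ uIcc (0:ℝ) 1, kappaP' νa ka y * conj (reflProfile (kappaP νb kb) y) = 0 := by
    intro y _
    by_cases hy : y < νa
    · have : kappaP νb kb (1 - y) = 0 := kappaP_of_lt (by linarith)
      simp [reflProfile, this]
    · rw [kappaP'_of_ge (not_lt.1 hy), zero_mul]
  have hz4 : ∀ y ∈ uIcc (0:ℝ) 1, kappaP νa ka y * conj (reflDeriv (kappaP' νb kb) y) = 0 := by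
    intro y _
    by_cases hy : y < νa
    · have : kappaP' νb kb (1 - y) = 0 := kappaP'_of_ge (by linarith)
      simp [reflDeriv, this]
    · rw [kappaP_of_ge ha.ne' (not_lt.1 hy), zero_mul]
  have hz5 : ∀ x ∈ uIcc (0:ℝ) 1,
      kappaP νa ka x * conj (∫ t in (0:ℝ)..x, reflProfile (kappaP νb kb) t) = 0 := by
    intro x hx
    rw [uIcc_of_le zero_le_one] at hx
    by_cases hxa : x < νa
    · rw [integral_reflProfile, integral_kappaP_tail_of_ge hb (by linarith) (by linarith [hx.1])]
      simp
    · rw [kappaP_of_ge ha.ne' (not_lt.1 hxa), zero_mul]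
  unfold Xw windowForm
  rw [intervalIntegral.integral_congr hz1, intervalIntegral.integral_congr hz2,
    intervalIntegral.integral_congr hz3, intervalIntegral.integral_congr hz4,
    intervalIntegral.integral_congr hz5]
  simp

/-! ### The reduction on the design -/

/-- Bounds from the admissible class used here (plumbing). [folklore] -/
private theorem adm_bounds' (h : AdmissibleTheta θ) :
    0 < θ.nu3 ∧ θ.nu3 ≤ θ.nu2 ∧ θ.nu2 ≤ θ.nu1 ∧ θ.nu2 ≤ 1 ∧ θ.nu1 ≤ 1 ∧ θ.nu3 ≤ 1
      ∧ θ.nu2 + θ.nu2 ≤ 1 ∧ θ.nu2 + θ.nu3 ≤ 1 := by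
  obtain ⟨⟨h32, h21⟩, ⟨h3h, h2h, h1h⟩, h1, h13, -, -, -⟩ := h
  unfold Theta.belowP at h1
  unfold Theta.dualRangesNonempty at h13
  exact ⟨by linarith, h32.le, h21.le, by linarith, h1.le, by linarith, by linarith, by linarith⟩

/-- **On the design the window form reduces to the two windows**:
`WT θ = ῑ₄·Xw ν₁ k₁ ν₂ k₂ + ῑ₃·Xw ν₁ k₁ ν₃ k₃` on `AdmissibleTheta θ` — the `ι₂ϰ(ν₂,k₂)` piece of `H₁`
does not meet the reflected `H₂` (`2ν₂ ≤ 1`, `ν₂ + ν₃ ≤ 1`). [cite: Zhang2022LandauSiegel, §12 (12.12)–(12.17); §18 (18.1)] -/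
theorem WT_eq_windows (h : AdmissibleTheta θ) :
    WT θ = conj θ.iota4 * Xw θ.nu1 θ.k1 θ.nu2 θ.k2 + conj θ.iota3 * Xw θ.nu1 θ.k1 θ.nu3 θ.k3 := by
  obtain ⟨h3, h32, h21, h2le, h1le, h3le, h22, h23⟩ := adm_bounds' h
  have h2 : 0 < θ.nu2 := by linarith
  have h1 : 0 < θ.nu1 := by linarith
  -- `H¹` witnesses of the pieces
  have K1 := (kinkedProfile_kappaP (k := θ.k1) h1 h1le).isH1
  have K2 := (kinkedProfile_kappaP (k := θ.k2) h2 h2le).isH1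
  have K3 := (kinkedProfile_kappaP (k := θ.k3) h3 h3le).isH1
  -- the profiles as explicit linear combinations
  have eu : h1Profile θ = fun x => kappaP θ.nu1 θ.k1 x + θ.iota2 * kappaP θ.nu2 θ.k2 x := by
    funext x; simp [h1Profile, pairProfile]
  have eu' : h1Profile' θ = fun x => kappaP' θ.nu1 θ.k1 x + θ.iota2 * kappaP' θ.nu2 θ.k2 x := by
    funext x; simp [h1Profile', pairProfile']
  have ev : reflProfile (h2Profile θ) = fun y => (fun y => θ.iota4 * reflProfile (kappaP θ.nu2 θ.k2) y) y
      + θ.iota3 * reflProfile (kappaP θ.nu3 θ.k3) y := by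
    funext y; simp [h2Profile, pairProfile, reflProfile, map_add, map_mul]
  have ev' : reflDeriv (h2Profile' θ) = fun y => (fun y => θ.iota4 * reflDeriv (kappaP' θ.nu2 θ.k2) y) y
      + θ.iota3 * reflDeriv (kappaP' θ.nu3 θ.k3) y := by
    funext y; simp [h2Profile', pairProfile', reflDeriv, map_add, map_mul]; ring
  unfold WT
  rw [eu, eu', ev, ev']
  rw [windowForm_add_smul_left K1 K2 ((isH1_smul K2.refl θ.iota4).add_smul K3.refl θ.iota3) θ.iota2]
  rw [windowForm_add_smul_right K1 (isH1_smul K2.refl θ.iota4) K3.refl θ.iota3,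
    windowForm_add_smul_right K2 (isH1_smul K2.refl θ.iota4) K3.refl θ.iota3,
    windowForm_smul_right K1 K2.refl θ.iota4, windowForm_smul_right K2 K2.refl θ.iota4]
  have z22 : Xw θ.nu2 θ.k2 θ.nu2 θ.k2 = 0 := windowForm_kappaP_refl_eq_zero h2 h2 h22
  have z23 : Xw θ.nu2 θ.k2 θ.nu3 θ.k3 = 0 := windowForm_kappaP_refl_eq_zero h2 h3 h23
  unfold Xw at z22 z23 ⊢
  rw [z22, z23]
  ring

/-- **The K-S2 discrepancy of record, window by window**:
`discS θ = ῑ₄·Xw ν₁ k₁ ν₂ k₂ + ῑ₃·Xw ν₁ k₁ ν₃ k₃ − 2·e2starT θ` on `AdmissibleTheta θ`.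
[cite: Zhang2022LandauSiegel, §12 (12.13)–(12.17); §18 (18.1)–(18.2)] -/
theorem discS_eq_windows (h : AdmissibleTheta θ) :
    discS θ = conj θ.iota4 * Xw θ.nu1 θ.k1 θ.nu2 θ.k2 + conj θ.iota3 * Xw θ.nu1 θ.k1 θ.nu3 θ.k3
      - 2 * e2starT θ := by
  rw [discS_eq h, WT_eq_windows h]

end Repair

end Literature.NumberTheory.LFunctions.Zhang2022
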